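import Literature.AlgebraicGeometry.Modules.FiniteType
import Literature.AlgebraicGeometry.Modules.TorsionQuotient
import Literature.AlgebraicGeometry.Modules.IdealSheafNoetherian
import HarnessLib

/-!
# Stabilisation of the torsion subsheaves `M[𝓘ᵏ]` and the `𝓘`-torsion-free quotient

For a coherent module `M` (affine-localizing of affine-finite type) on a quasi-compact locally
Noetherian scheme `X` and an ideal sheaf `𝓘`, the increasing chain of torsion subsheaves
`M[𝓘] ⊆ M[𝓘²] ⊆ ⋯` (`Modules/Torsion`) stabilises (`exists_torsion_pow_stable`): on each of finitely
many affine opens this is the ascending chain condition for submodules of the Noetherian module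
`Γ(V, M)`, and the torsion condition on an arbitrary affine open is controlled from a covering piece
through numerators on common principal opens (`IsTorsionSection.of_cover`). Consequently the quotient
`M/M[𝓘ᵏ]` by the stable term has NO `𝓘`-torsion (`torsionFree_cokernel_torsionι`). This is the
classical `Γ_𝓘(M) = M[𝓘ᵏ]` for `k ≫ 0` and the `𝓘`-torsion-freeness of `M/Γ_𝓘(M)` (Hartshorne II
Ex. 5.6 (d): "`Γ_𝔞(M) = {m ∈ M | 𝔞ⁿm = 0 for some n > 0}`"; Stacks 0BVG), used to make extensions of
sections across `V(𝓘)` unique in step (iii) of the dévissage (Görtz–Wedhorn I, Lemma 12.63).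

* `IsTorsionSection.of_cover` — the torsion condition is local on the open;
* `exists_torsion_pow_stable` — `∃ k, M[𝓘ᵏ⁺¹] = M[𝓘ᵏ]` (as a statement about sections on all opens);
* `torsionFree_cokernel_torsionι` — for such `k`, a section of `M/M[𝓘ᵏ]` over an affine open killed by
  `𝓘` is zero.

Everything is proved; no named facts. Mathlib searched (pin v4.32): `monotone_stabilizes_iff_noetherian`,
`isNoetherian_of_isNoetherianRing_of_finite` (used).

## References

* R. Hartshorne, *Algebraic Geometry* (1977): II Ex. 5.6 (d), p. 124. [Hartshorne1977]
* U. Görtz, T. Wedhorn, *Algebraic Geometry I*, 2nd ed. (2020): Lemma 12.63 (iii). [GortzWedhorn2020]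
-/

noncomputable section

open CategoryTheory CategoryTheory.Limits AlgebraicGeometry TopologicalSpace Opposite
open Literature.AlgebraicGeometry.Morphisms

universe u

namespace Literature.AlgebraicGeometry.Modules

variable {X : Scheme.{u}} (M : X.Modules) (J : X.IdealSheafData)

/-- **The torsion condition is local**: if `m|_{W_l}` is a torsion section for a family of opens
`W_l ⊆ V` covering `V`, then `m` is a torsion section. [folklore] -/
theorem IsTorsionSection.of_cover {V : X.Opens} {ι : Type u} (W : ι → X.Opens) (hWV : ∀ l, W l ≤ V)
    (hcov : V ≤ ⨆ l, W l) (m : Γ(M, V))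
    (hm : ∀ l, IsTorsionSection M J (W l) (M.presheaf.map (homOfLE (hWV l)).op m)) :
    IsTorsionSection M J V m := by
  intro V' hV' r hr
  let K : Type u := {W' : X.affineOpens // ∃ l, (W' : X.Opens) ≤ (V' : X.Opens) ⊓ W l}
  have hcov' : (V' : X.Opens) ≤ ⨆ k : K, (k.1 : X.Opens) := by
    intro x hx
    obtain ⟨l, hl⟩ := Opens.mem_iSup.mp (hcov (hV' hx))
    obtain ⟨W', hW', hxW', hW'le⟩ :=
      Opens.isBasis_iff_nbhd.mp X.isBasis_affineOpens (show x ∈ (V' : X.Opens) ⊓ W l from ⟨hx, hl⟩)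
    exact Opens.mem_iSup.mpr ⟨⟨⟨W', hW'⟩, l, hW'le⟩, hxW'⟩
  apply (abSheafOf M).eq_of_locally_eq' (fun k : K => (k.1 : X.Opens)) V'
    (fun k => homOfLE (k.2.choose_spec.trans inf_le_left)) hcov'
  intro k
  obtain ⟨l, hl⟩ := k.2
  have hkV : (k.1 : X.Opens) ≤ V' := hl.trans inf_le_left
  have hkW : (k.1 : X.Opens) ≤ W l := hl.trans inf_le_right
  rw [map_zero]
  change M.presheaf.map (homOfLE _).op (r • M.presheaf.map (homOfLE hV').op m) = 0
  rw [Scheme.Modules.map_smul, ← CategoryTheory.comp_apply, ← Functor.map_comp]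
  have key := hm l k.1 hkW (X.presheaf.map (homOfLE hkV).op r) (J.ideal_le_comap_ideal hkV hr)
  rw [← CategoryTheory.comp_apply, ← Functor.map_comp] at key
  exact (congrArg (fun φ => X.presheaf.map (homOfLE hkV).op r • M.presheaf.map φ m)
    (Subsingleton.elim _ _)).trans key

/-- The torsion submodules `Γ(V, M[𝓘ᶜ])` increase with `c`. [folklore] -/
theorem torsionSubmoduleObj_pow_mono (V : X.Opens) :
    Monotone fun c : ℕ => torsionSubmoduleObj M (J ^ c) V := by
  intro c c' hcc' m hm W hW r hr
  refine hm W hW r ?_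
  have : (J ^ c').ideal W ≤ (J ^ c).ideal W := by
    rw [Scheme.IdealSheafData.ideal_pow, Scheme.IdealSheafData.ideal_pow]
    exact Ideal.pow_le_pow_right hcc'
  exact this hr

variable {M J}

/-- On an affine `V`, a section killed by the generators' restrictions... : if `x ∈ Γ(V, M)` is killed by
`𝓘(V)ᶜ` then `x|_W` is an `𝓘ᶜ`-torsion section for every open `W ⊆ V`. [folklore] -/
theorem isTorsionSection_pow_of_forall_smul_eq_zero {V : X.Opens} (hV : IsAffineOpen V) (c : ℕ)
    (x : Γ(M, V)) (hx : ∀ a ∈ J.ideal ⟨V, hV⟩ ^ c, a • x = 0) {W : X.Opens} (hWV : W ≤ V) :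
    IsTorsionSection M (J ^ c) W (M.presheaf.map (homOfLE hWV).op x) := by
  refine (IsTorsionSection.map ?_ hWV)
  rw [isTorsionSection_iff_of_isAffineOpen M (J ^ c) hV]
  intro a ha
  rw [Scheme.IdealSheafData.ideal_pow] at ha
  exact hx a ha

/-- **Stabilisation of `M[𝓘ᵏ]`** for `M` coherent on a quasi-compact locally Noetherian scheme:
there is `k` with `M[𝓘ᵏ⁺¹] = M[𝓘ᵏ]`. [cite: Hartshorne1977, II Ex. 5.6 (d) (p. 124)] -/
theorem exists_torsion_pow_stable [IsLocallyNoetherian X] [CompactSpace X] (hM : IsAffineLocalizing M)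
    (hMft : IsAffineFiniteType M) :
    ∃ k : ℕ, ∀ (V : X.Opens) (m : Γ(M, V)),
      IsTorsionSection M (J ^ (k + 1)) V m → IsTorsionSection M (J ^ k) V m := by
  classical
  obtain ⟨t, ht⟩ := exists_finite_affineOpens_iSup_eq_top (X := X)
  -- stabilisation on each covering piece
  have hstab : ∀ V : t, ∃ k : ℕ, ∀ c, k ≤ c →
      torsionSubmoduleObj M (J ^ k) ((V : X.affineOpens) : X.Opens) =
        torsionSubmoduleObj M (J ^ c) ((V : X.affineOpens) : X.Opens) := by
    intro V
    haveI : IsNoetherianRing Γ(X, ((V : X.affineOpens) : X.Opens)) :=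
      IsLocallyNoetherian.component_noetherian (V : X.affineOpens)
    haveI := hMft (V : X.affineOpens).2
    haveI : IsNoetherian Γ(X, ((V : X.affineOpens) : X.Opens)) Γ(M, ((V : X.affineOpens) : X.Opens)) :=
      isNoetherian_of_isNoetherianRing_of_finite _ _
    obtain ⟨k, hk⟩ := monotone_stabilizes_iff_noetherian.mpr inferInstance
      ⟨fun c => torsionSubmoduleObj M (J ^ c) ((V : X.affineOpens) : X.Opens),
        torsionSubmoduleObj_pow_mono M J _⟩
    exact ⟨k, fun c hc => hk c hc⟩
  choose k hk using hstab
  refine ⟨Finset.univ.sup k, fun V m hm => ?_⟩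
  set K := Finset.univ.sup k with hKdef
  -- check the torsion condition on the opens which are principal in some covering piece and inside `V`
  let L : Type u := {p : Σ i : t, Γ(X, ((i.1 : X.affineOpens) : X.Opens)) // X.basicOpen p.2 ≤ V}
  refine IsTorsionSection.of_cover M (J ^ K) (fun l : L => X.basicOpen l.1.2) (fun l => l.2) ?_ m ?_
  · intro x hx
    have hx' : x ∈ (⊤ : X.Opens) := trivial
    rw [← ht] at hx'
    obtain ⟨i, hi⟩ := Opens.mem_iSup.mp hx'
    obtain ⟨g, hgV, hxg⟩ := (i : X.affineOpens).2.exists_basicOpen_le (V := V) ⟨x, hx⟩ hi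
    exact Opens.mem_iSup.mpr ⟨⟨⟨i, g⟩, hgV⟩, hxg⟩
  intro l
  obtain ⟨⟨i, g⟩, hgV⟩ := l
  have hVi : IsAffineOpen ((i : X.affineOpens) : X.Opens) := (i : X.affineOpens).2
  set W := X.basicOpen g with hWdef
  have hWi : W ≤ (i : X.affineOpens) := X.basicOpen_le g
  have hWaff : IsAffineOpen W := hVi.basicOpen g
  -- `m|_W` is killed by `(𝓘^{K+1})(W)`; numerators in the piece `V_i`
  have hmW : IsTorsionSection M (J ^ (K + 1)) W (M.presheaf.map (homOfLE hgV).op m) := hm.map hgV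
  obtain ⟨N, x, hx⟩ := hM.numerator hVi g rfl (M.presheaf.map (homOfLE hgV).op m)
  -- generators of `𝓘(V_i)^{K+1}` kill `x` after multiplying by a power of `g`
  haveI : IsNoetherianRing Γ(X, ((i : X.affineOpens) : X.Opens)) :=
    IsLocallyNoetherian.component_noetherian (i : X.affineOpens)
  obtain ⟨G, hG⟩ := (IsNoetherian.noetherian (J.ideal (i : X.affineOpens) ^ (K + 1)) :
    (J.ideal (i : X.affineOpens) ^ (K + 1)).FG)
  have hkill : ∀ a ∈ G, ∃ e : ℕ, g ^ e • (a • x) = 0 := by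
    intro a ha
    have haJ : a ∈ J.ideal (i : X.affineOpens) ^ (K + 1) := hG ▸ Ideal.subset_span ha
    refine hM.torsion hVi g (a • x) hWi le_rfl ?_
    rw [Scheme.Modules.map_smul, hx, smul_smul, mul_comm, mul_smul]
    have haW : X.presheaf.map (homOfLE hWi).op a ∈ (J ^ (K + 1)).ideal ⟨W, hWaff⟩ := by
      rw [Scheme.IdealSheafData.ideal_pow, Pi.pow_apply,
        ← J.map_ideal (U := ⟨W, hWaff⟩) (V := (i : X.affineOpens)) hWi, ← Ideal.map_pow]
      exact Ideal.mem_map_of_mem _ haJ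
    have := (isTorsionSection_iff_of_isAffineOpen M _ hWaff _).mp hmW _ haW
    rw [this, smul_zero]
  choose! e he using hkill
  set E := G.sup e with hE
  have hxE : ∀ a ∈ J.ideal (i : X.affineOpens) ^ (K + 1), a • (g ^ E • x) = 0 := by
    intro a ha
    rw [← hG] at ha
    refine Submodule.span_induction (p := fun a _ => a • (g ^ E • x) = 0) ?_ ?_ ?_ ?_ ha
    · intro a haG
      rw [← pow_sub_mul_pow g (Finset.le_sup haG : e a ≤ E), mul_smul, smul_comm a (g ^ (E - e a)),
        smul_comm a (g ^ e a), he a haG, smul_zero]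
    · rw [zero_smul]
    · intro a b _ _ ha hb; rw [add_smul, ha, hb, add_zero]
    · intro c a _ ha; rw [smul_eq_mul, mul_smul, ha, smul_zero]
  -- so `g^E x ∈ M[𝓘^{K+1}](V_i) = M[𝓘^{k_i}](V_i) ⊆ M[𝓘^K](V_i)`
  have hmem : g ^ E • x ∈ torsionSubmoduleObj M (J ^ (K + 1)) ((i : X.affineOpens) : X.Opens) := by
    rw [mem_torsionSubmoduleObj_iff, isTorsionSection_iff_of_isAffineOpen M _ hVi]
    intro a ha
    rw [Scheme.IdealSheafData.ideal_pow, Pi.pow_apply] at ha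
    exact hxE a ha
  have hKi : k i ≤ K := Finset.le_sup (Finset.mem_univ i)
  rw [← hk i (K + 1) (hKi.trans (Nat.le_succ K)), hk i K hKi, mem_torsionSubmoduleObj_iff,
    isTorsionSection_iff_of_isAffineOpen M _ hVi] at hmem
  -- transport back to `W`, where `g` is a unit
  rw [isTorsionSection_iff_of_isAffineOpen M _ hWaff]
  intro r hr
  rw [Scheme.IdealSheafData.ideal_pow, Pi.pow_apply,
    ← J.map_ideal (U := ⟨W, hWaff⟩) (V := (i : X.affineOpens)) hWi, ← Ideal.map_pow] at hr
  have hu : IsUnit (X.presheaf.map (homOfLE hWi).op g) := X.toRingedSpace.isUnit_res_basicOpen g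
  refine (IsUnit.smul_left_cancel (hu.pow (E + N))).mp ?_
  rw [smul_zero, smul_comm, pow_add, mul_smul, ← hx, ← map_pow, ← Scheme.Modules.map_smul]
  -- now `r • M.map (g^E • x) = 0` for `r ∈ (𝓘(V_i)^K)·Γ(W)`
  refine Submodule.span_induction (p := fun r _ => r • M.presheaf.map (homOfLE hWi).op (g ^ E • x) = 0)
    ?_ ?_ ?_ ?_ hr
  · rintro _ ⟨a, ha, rfl⟩
    change X.presheaf.map (homOfLE hWi).op a • _ = 0
    rw [← Scheme.Modules.map_smul, hmem a (by rw [Scheme.IdealSheafData.ideal_pow, Pi.pow_apply]; exact ha),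
      map_zero]
  · rw [zero_smul]
  · intro a b _ _ ha hb; rw [add_smul, ha, hb, add_zero]
  · intro c a _ ha; rw [smul_eq_mul, mul_smul, ha, smul_zero]

/-- **The quotient `M/M[𝓘ᵏ]` by the stable torsion subsheaf has no `𝓘`-torsion**: a section over an
affine open killed by `𝓘` vanishes. [cite: Hartshorne1977, II Ex. 5.6 (d) (p. 124)] -/
theorem torsionFree_cokernel_torsionι [IsLocallyNoetherian X] (hM : IsAffineLocalizing M) {k : ℕ}
    (hk : ∀ (V : X.Opens) (m : Γ(M, V)),
      IsTorsionSection M (J ^ (k + 1)) V m → IsTorsionSection M (J ^ k) V m)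
    {V : X.Opens} (hV : IsAffineOpen V) (q : Γ(cokernel (torsionι M (J ^ k)), V))
    (hq : ∀ a ∈ J.ideal ⟨V, hV⟩, a • q = 0) : q = 0 := by
  have hS := shortExact_torsion M (J ^ k)
  obtain ⟨m, rfl⟩ := app_surjective_of_shortExact hS
    (isAffineLocalizing_torsion (J ^ k) hM (IdealSheafData.fg_ideal _)) hV q
  -- `𝓘(V) m ⊆ M[𝓘^k](V)`, so `m ∈ M[𝓘^{k+1}](V) = M[𝓘^k](V)`
  have hm : IsTorsionSection M (J ^ (k + 1)) V m := by
    rw [isTorsionSection_iff_of_isAffineOpen M _ hV]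
    intro a ha
    rw [Scheme.IdealSheafData.ideal_pow, Pi.pow_apply, pow_succ] at ha
    refine Submodule.mul_induction_on ha (fun b hb c hc => ?_) (fun a a' ha ha' => by rw [add_smul, ha, ha', add_zero])
    rw [mul_smul]
    -- `c • m ∈ M[𝓘^k](V)`
    have h0 : (cokernel.π (torsionι M (J ^ k))).app V (c • m) = 0 := by
      rw [Scheme.Modules.Hom.app_smul]; exact hq c hc
    obtain ⟨y, hy⟩ := (sections_exact_of_shortExact hS V).2 (c • m) h0
    change (torsionι M (J ^ k)).app V y = c • m at hy
    rw [← hy, ← Scheme.Modules.Hom.app_smul]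
    have hy' := (isTorsionSection_iff_of_isAffineOpen M _ hV _).mp
      (isTorsionSection_torsionι_app M (J ^ k) V y) b
      (by rw [Scheme.IdealSheafData.ideal_pow, Pi.pow_apply]; exact hb)
    rw [Scheme.Modules.Hom.app_smul, hy']
  have hm' := hk V m hm
  obtain ⟨y, hy⟩ := exists_torsionι_app_eq M (J ^ k) m hm'
  rw [← hy]
  exact app_app_eq_zero (ShortComplex.mk (torsionι M (J ^ k)) (cokernel.π (torsionι M (J ^ k)))
    (cokernel.condition _)) V y

end Literature.AlgebraicGeometry.Modules

end
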